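import Literature.NumberTheory.EllipticCurves.IsogenyComplexUniformizationProofs
import Literature.NumberTheory.EllipticCurves.Greenberg1999.TwoTorsionOddCriterionProofs
import Summits.BirchSwinnertonDyer.BirchSwinnertonDyer.Theorems.EisensteinDepletionAtTwoStarOptBNSFOddTransportArchAlgebra
import HarnessLib

/-!
# Transport of Greenberg's «odd» type along isogenies, II: «odd» ⟺ an ANTI-REAL half in `E(ℂ)`
# (line `nsf` on crux `StarOptBNSF`, item stmt-BirchSwinnertonDyer-27047, stub `stub_regimeTransport`)

Lead bsd-rank2-star-p1 GEN 7.  For `W/ℚ` and a rational point `T = (x, y)` of order `2`, Greenberg's type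
bit «`⟨T⟩` is odd» (`TwoTorsionOdd W x`: `x` is the LEAST real root of the 2-division cubic, i.e. `T`
generates `C_∞[2]`, LNM 1716 §5) has an intrinsic description on complex points:

  **`T` is odd iff `T` has an ANTI-REAL half — a point `R ∈ W(ℂ)` with `conj R = −R` and `R + R = T`.**

[On `ℂ/Λ`, `Λ` real: `C_∞` is the image of the imaginary axis, the odd 2-torsion point is `ω⁻/2` with
`ℤω⁻ = Λ ∩ iℝ`, and the anti-real points are `{z̄ ≡ −z}` ⊇ `iℝ/ℤω⁻`.]  Concretely the halves of `T` have
abscissa `r = x ± √(β/2)`, `β = b₄ + x b₂ + 6x²` (part I, `addX_self_eq_iff`), and a half with real abscissa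
`r` is anti-real iff `f(r) < 0`; the sign bookkeeping is the tree's exact test `twoTorsionOdd_iff_sign'`
(`Greenberg1999/TwoTorsionOddCriterionProofs`) for `exists_antireal_half_of_twoTorsionOdd` and part I's
`least_root_of_neg_at_half` for `twoTorsionOdd_of_antireal_half`.  Complex conjugation acts on `W(ℂ)`
coordinatewise through a `ℚ`-algebra map `σc = conj` (tree `exists_algHom_conj`).

HONEST FRAMING: an elementary dictionary under an OPEN crux; nothing here reads an analytic rank;
`StarOptBNSF` (27047) / `E1M_NSF` (27021) / BSD are NOT proved by it.

References: R. Greenberg, *Iwasawa theory for elliptic curves*, LNM 1716 (1999), §5 p. 168 («odd»: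
`Φ ⊆ C_∞`), Remark p. 174 (least `x`-coordinate) [GreenbergLNM1716]; J. H. Silverman, *AEC*, GTM 106
(2009), III.2.3 [SilvermanAEC2009]; *ATAEC* V.2 (`E(ℝ)`, conjugation on `E(ℂ)`).
-/

set_option linter.dupNamespace false
set_option autoImplicit false

noncomputable section

open scoped Classical ComplexConjugate
open WeierstrassCurve Literature.NumberTheory.EllipticCurves
  Literature.NumberTheory.EllipticCurves.Greenberg1999 Complex

namespace Summit.BirchSwinnertonDyer.BirchSwinnertonDyer.Theorems.DepletionAtTwo.ArchTransport

/-! ### §2 Complex points of a curve over `ℚ`: anti-real halves -/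

section Complex

variable (W : WeierstrassCurve ℚ)

/-- `a₁(W/ℂ) = a₁(W)` (cast). [folklore] -/
@[simp] theorem bc_a₁ : (W.baseChange ℂ).a₁ = (W.a₁ : ℂ) := by
  simp [WeierstrassCurve.baseChange]

/-- `a₂(W/ℂ) = a₂(W)` (cast). [folklore] -/
@[simp] theorem bc_a₂ : (W.baseChange ℂ).a₂ = (W.a₂ : ℂ) := by
  simp [WeierstrassCurve.baseChange]

/-- `a₃(W/ℂ) = a₃(W)` (cast). [folklore] -/
@[simp] theorem bc_a₃ : (W.baseChange ℂ).a₃ = (W.a₃ : ℂ) := by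
  simp [WeierstrassCurve.baseChange]

/-- `a₄(W/ℂ) = a₄(W)` (cast). [folklore] -/
@[simp] theorem bc_a₄ : (W.baseChange ℂ).a₄ = (W.a₄ : ℂ) := by
  simp [WeierstrassCurve.baseChange]

/-- `a₆(W/ℂ) = a₆(W)` (cast). [folklore] -/
@[simp] theorem bc_a₆ : (W.baseChange ℂ).a₆ = (W.a₆ : ℂ) := by
  simp [WeierstrassCurve.baseChange]

/-- `b₂(W/ℂ) = b₂(W)` (cast). [folklore] -/
@[simp] theorem bc_b₂ : (W.baseChange ℂ).b₂ = (W.b₂ : ℂ) := by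
  simp [WeierstrassCurve.baseChange]

/-- `b₄(W/ℂ) = b₄(W)` (cast). [folklore] -/
@[simp] theorem bc_b₄ : (W.baseChange ℂ).b₄ = (W.b₄ : ℂ) := by
  simp [WeierstrassCurve.baseChange]

/-- `b₆(W/ℂ) = b₆(W)` (cast). [folklore] -/
@[simp] theorem bc_b₆ : (W.baseChange ℂ).b₆ = (W.b₆ : ℂ) := by
  simp [WeierstrassCurve.baseChange]

/-- Complex conjugation fixes `ℚ ⊆ ℂ`. [folklore] -/
theorem conj_algebraMap_rat (q : ℚ) : conj (algebraMap ℚ ℂ q) = algebraMap ℚ ℂ q := by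
  rw [eq_ratCast, map_ratCast]

/-- Complex conjugation as a `ℚ`-algebra endomorphism of `ℂ` (tree `exists_algHom_conj`). [folklore] -/
theorem exists_algHom_conj_rat : ∃ σc : ℂ →ₐ[ℚ] ℂ, ∀ z, σc z = conj z :=
  exists_algHom_conj (K := ℚ) conj_algebraMap_rat

/-- The real 2-division cubic of `W` at a real abscissa, cast to `ℂ`, is the 2-division cubic of `W/ℂ`. -/
theorem cubic_ofReal (ρ : ℝ) :
    ((4 * ρ ^ 3 + (W.b₂ : ℝ) * ρ ^ 2 + 2 * (W.b₄ : ℝ) * ρ + (W.b₆ : ℝ) : ℝ) : ℂ) =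
      4 * (ρ : ℂ) ^ 3 + (W.baseChange ℂ).b₂ * (ρ : ℂ) ^ 2 + 2 * (W.baseChange ℂ).b₄ * (ρ : ℂ) +
        (W.baseChange ℂ).b₆ := by
  simp only [bc_b₂, bc_b₄, bc_b₆]
  push_cast
  ring

variable {W}

/-- **An anti-real half forces «odd».**  If `T = (x, y)` is a rational point of order `2` of `W` and
`R ∈ W(ℂ)` satisfies `conj R = −R` and `R + R = T` (any point of `W(ℂ)` with abscissa `x`), then `⟨T⟩` is
odd: writing `R = (r, s)`, `r` is real, `w = 2s + a₁r + a₃` is purely imaginary and non-zero, so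
`f(r) = w² < 0`, and `x(2R) = x` gives `2(r − x)² = b₄ + x b₂ + 6x²`; conclude by
`least_root_of_neg_at_half`. [cite: GreenbergLNM1716, §5 p. 168 (odd = generates C_∞[2]) and Remark p. 174 (least x-coordinate)] -/
theorem twoTorsionOdd_of_antireal_half {x y : ℚ} (hxy : W.toAffine.Equation x y)
    (h2 : 2 * y + W.a₁ * x + W.a₃ = 0) (σc : ℂ →ₐ[ℚ] ℂ) (hσc : ∀ z, σc z = conj z)
    {R : (W.baseChange ℂ).toAffine.Point} (hanti : Affine.Point.map (W' := W) σc R = -R)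
    {X Y : ℂ} {hP : (W.baseChange ℂ).toAffine.Nonsingular X Y} (hX : X = (x : ℂ))
    (hhalf : R + R = .some X Y hP) : TwoTorsionOdd W x := by
  -- the real cubic vanishes at `x`
  have hfx : 4 * (x : ℝ) ^ 3 + (W.b₂ : ℝ) * (x : ℝ) ^ 2 + 2 * (W.b₄ : ℝ) * (x : ℝ) + (W.b₆ : ℝ) = 0 :=
    fourXCubed_add_eq_zero_of_twoTorsion_real hxy h2
  have hfxC : 4 * (x : ℂ) ^ 3 + (W.baseChange ℂ).b₂ * (x : ℂ) ^ 2 + 2 * (W.baseChange ℂ).b₄ * (x : ℂ) +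
      (W.baseChange ℂ).b₆ = 0 := by
    have := congrArg (fun q : ℝ ↦ (q : ℂ)) hfx
    simp only [Complex.ofReal_zero] at this
    rw [← this, cubic_ofReal]
    push_cast; ring
  -- `R` is affine
  rcases R with _ | ⟨r, s, hrs⟩
  · have h0 : (0 : (W.baseChange ℂ).toAffine.Point) + 0 = .some X Y hP := hhalf
    rw [add_zero] at h0
    exact absurd h0 (by rintro ⟨⟩)
  -- anti-real: `conj r = r`, `conj s = negY r s`
  rw [Affine.Point.map_some, Affine.Point.neg_some, Affine.Point.some.injEq, hσc, hσc] at hanti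
  obtain ⟨hr, hs⟩ := hanti
  have hw : s ≠ (W.baseChange ℂ).toAffine.negY r s := by
    intro hsw
    rw [Affine.Point.add_self_of_Y_eq hsw] at hhalf
    exact absurd hhalf (by rintro ⟨⟩)
  rw [Affine.Point.add_self_of_Y_ne hw, Affine.Point.some.injEq] at hhalf
  obtain ⟨haddX, -⟩ := hhalf
  rw [hX] at haddX
  have ht := (addX_self_eq_iff (W.baseChange ℂ) hrs.1 hw hfxC).mp haddX
  -- `w = 2s + a₁ r + a₃` is purely imaginary and non-zero, `w² = f(r)`
  set w := 2 * s + (W.baseChange ℂ).a₁ * r + (W.baseChange ℂ).a₃ with hwdef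
  have hw0 : w ≠ 0 := by rw [hwdef, ← sub_negY_eq]; exact sub_ne_zero.mpr hw
  have hconjw : conj w = -w := by
    rw [hwdef, WeierstrassCurve.Affine.negY] at *
    simp only [map_add, map_mul, map_ofNat, hs, hr, bc_a₁, bc_a₃, map_ratCast]
    ring
  have hwre : w.re = 0 := by
    have := congrArg Complex.re hconjw
    simp only [Complex.conj_re, Complex.neg_re] at this
    linarith
  have hwsq : w ^ 2 = -((w.im : ℝ) : ℂ) ^ 2 := by
    have hw' : w = (w.im : ℂ) * I := by
      apply Complex.ext <;> simp [hwre]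
    calc w ^ 2 = ((w.im : ℂ) * I) ^ 2 := by rw [← hw']
      _ = -((w.im : ℝ) : ℂ) ^ 2 := by rw [mul_pow, Complex.I_sq]; ring
  have hwim : w.im ≠ 0 := by
    intro h0; apply hw0; apply Complex.ext <;> simp [hwre, h0]
  -- `r` is real
  have hrre : r = ((r.re : ℝ) : ℂ) := (Complex.conj_eq_iff_re.mp hr).symm
  set r₀ : ℝ := r.re with hr₀
  set t : ℝ := r₀ - x with htdef
  have hsq := sq_eq_cubic_of_equation (W.baseChange ℂ) hrs.1
  rw [← hwdef] at hsq
  -- the real statements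
  have htR : 2 * t ^ 2 = (W.b₄ : ℝ) + (x : ℝ) * (W.b₂ : ℝ) + 6 * (x : ℝ) ^ 2 := by
    apply Complex.ofReal_injective
    push_cast
    rw [htdef]; push_cast
    rw [← hrre]
    simpa only [bc_b₂, bc_b₄] using ht
  have hnegR : 4 * ((x : ℝ) + t) ^ 3 + (W.b₂ : ℝ) * ((x : ℝ) + t) ^ 2 + 2 * (W.b₄ : ℝ) * ((x : ℝ) + t) +
      (W.b₆ : ℝ) < 0 := by
    have hxt : (x : ℝ) + t = r₀ := by rw [htdef]; ring
    rw [hxt]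
    have hval : ((4 * r₀ ^ 3 + (W.b₂ : ℝ) * r₀ ^ 2 + 2 * (W.b₄ : ℝ) * r₀ + (W.b₆ : ℝ) : ℝ) : ℂ) =
        ((-(w.im ^ 2) : ℝ) : ℂ) := by
      rw [cubic_ofReal, ← hrre, ← hsq, hwsq]; push_cast; ring
    rw [Complex.ofReal_injective hval]
    have : 0 < w.im ^ 2 := by positivity
    linarith
  intro ρ hρ
  exact least_root_of_neg_at_half hfx htR hnegR ρ hρ

/-- **«Odd» produces an anti-real half.**  If `T = (x, y)` is a rational point of order `2` with `⟨T⟩` odd,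
then for the tree's sign data `β = b₄ + x b₂ + 6x² > 0`, `α = b₂ + 12x < 8√(β/2)` the point
`R = (x − √(β/2), s) ∈ W(ℂ)` with `2s + a₁r + a₃ = i·√(−f(r))` is anti-real and `R + R = T`.
[cite: GreenbergLNM1716, §5 p. 168 and Remark p. 174] -/
theorem exists_antireal_half_of_twoTorsionOdd [W.IsElliptic] {x y : ℚ} (hxy : W.toAffine.Equation x y)
    (h2 : 2 * y + W.a₁ * x + W.a₃ = 0) (hodd : TwoTorsionOdd W x)
    (σc : ℂ →ₐ[ℚ] ℂ) (hσc : ∀ z, σc z = conj z)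
    {X Y : ℂ} (hP : (W.baseChange ℂ).toAffine.Nonsingular X Y) (hX : X = (x : ℂ)) (hY : Y = (y : ℂ)) :
    ∃ R : (W.baseChange ℂ).toAffine.Point,
      Affine.Point.map (W' := W) σc R = -R ∧ R + R = .some X Y hP := by
  obtain ⟨hβ, hα⟩ := (twoTorsionOdd_iff_sign' W ⟨y, hxy, h2⟩).mp hodd
  set β : ℝ := ((W.b₄ + x * W.b₂ + 6 * x ^ 2 : ℚ) : ℝ) with hβdef
  set α : ℝ := ((W.b₂ + 12 * x : ℚ) : ℝ) with hαdef
  have hβpos : 0 < β := by rw [hβdef]; exact_mod_cast hβ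
  set u : ℝ := Real.sqrt (β / 2) with hudef
  have hupos : 0 < u := Real.sqrt_pos.mpr (by linarith)
  have husq : u ^ 2 = β / 2 := Real.sq_sqrt (by linarith)
  have hαu : α < 8 * u := by
    rcases hα with hα | hα
    · have : α < 0 := by rw [hαdef]; exact_mod_cast hα
      linarith
    · have h32 : α ^ 2 < 32 * β := by rw [hαdef, hβdef]; exact_mod_cast hα
      nlinarith [husq, hupos]
  set t : ℝ := -u with htdef
  have ht2 : 2 * t ^ 2 = (W.b₄ : ℝ) + (x : ℝ) * (W.b₂ : ℝ) + 6 * (x : ℝ) ^ 2 := by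
    have : 2 * t ^ 2 = β := by rw [htdef, neg_sq, husq]; ring
    rw [this, hβdef]; push_cast; ring
  have hfx : 4 * (x : ℝ) ^ 3 + (W.b₂ : ℝ) * (x : ℝ) ^ 2 + 2 * (W.b₄ : ℝ) * (x : ℝ) + (W.b₆ : ℝ) = 0 :=
    fourXCubed_add_eq_zero_of_twoTorsion_real hxy h2
  -- the value of the cubic at the half-abscissa is negative
  set r₀ : ℝ := (x : ℝ) + t with hr₀
  set m : ℝ := 4 * r₀ ^ 3 + (W.b₂ : ℝ) * r₀ ^ 2 + 2 * (W.b₄ : ℝ) * r₀ + (W.b₆ : ℝ) with hmdef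
  have hm : m = t ^ 2 * (α + 8 * t) := by
    rw [hmdef, hr₀, cubic_shift, hfx, zero_add, hαdef]
    push_cast
    have : 2 * (↑W.b₄ + ↑x * ↑W.b₂ + 6 * (x : ℝ) ^ 2) = 4 * t ^ 2 := by rw [← ht2]; ring
    rw [this]; ring
  have hmneg : m < 0 := by
    rw [hm, htdef]
    have : α + 8 * -u < 0 := by linarith
    nlinarith [hupos, this]
  set v : ℝ := Real.sqrt (-m) with hvdef
  have hvsq : v ^ 2 = -m := Real.sq_sqrt (by linarith)
  -- the complex point
  set r : ℂ := (r₀ : ℂ) with hrdef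
  set w : ℂ := (v : ℂ) * I with hwdef
  have hwsq : w ^ 2 = (m : ℂ) := by
    rw [hwdef, mul_pow, Complex.I_sq, ← Complex.ofReal_pow, hvsq]; push_cast; ring
  have hw0 : w ≠ 0 := by
    rw [hwdef]
    have hv0 : v ≠ 0 := by
      intro h0; rw [h0] at hvsq; norm_num at hvsq; linarith
    exact mul_ne_zero (Complex.ofReal_ne_zero.mpr hv0) Complex.I_ne_zero
  set s : ℂ := (w - (W.baseChange ℂ).a₁ * r - (W.baseChange ℂ).a₃) / 2 with hsdef
  have hws : 2 * s + (W.baseChange ℂ).a₁ * r + (W.baseChange ℂ).a₃ = w := by rw [hsdef]; ring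
  have hcubic : (m : ℂ) = 4 * r ^ 3 + (W.baseChange ℂ).b₂ * r ^ 2 + 2 * (W.baseChange ℂ).b₄ * r +
      (W.baseChange ℂ).b₆ := by rw [hmdef, cubic_ofReal]
  have heq : (W.baseChange ℂ).toAffine.Equation r s := by
    rw [WeierstrassCurve.Affine.equation_iff]
    have h4 : (2 * s + (W.baseChange ℂ).a₁ * r + (W.baseChange ℂ).a₃) ^ 2 =
        4 * r ^ 3 + (W.baseChange ℂ).b₂ * r ^ 2 + 2 * (W.baseChange ℂ).b₄ * r + (W.baseChange ℂ).b₆ := by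
      rw [hws, hwsq, hcubic]
    simp only [WeierstrassCurve.b₂, WeierstrassCurve.b₄, WeierstrassCurve.b₆] at h4
    linear_combination h4 / 4
  have hns : (W.baseChange ℂ).toAffine.Nonsingular r s :=
    (WeierstrassCurve.Affine.equation_iff_nonsingular).mp heq
  refine ⟨.some r s hns, ?_, ?_⟩
  · -- anti-real
    have hconjr : conj r = r := by rw [hrdef]; exact Complex.conj_ofReal _
    have hconjw : conj w = -w := by
      rw [hwdef, map_mul, Complex.conj_ofReal, Complex.conj_I]; ring
    rw [Affine.Point.map_some, Affine.Point.neg_some, Affine.Point.some.injEq, hσc, hσc]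
    refine ⟨hconjr, ?_⟩
    rw [WeierstrassCurve.Affine.negY, hsdef]
    simp only [map_div₀, map_sub, map_mul, map_ofNat, hconjw, hconjr, bc_a₁, bc_a₃, map_ratCast]
    ring
  · -- `R + R = T`
    have hw : s ≠ (W.baseChange ℂ).toAffine.negY r s := by
      rw [← sub_ne_zero, sub_negY_eq, hws]; exact hw0
    rw [Affine.Point.add_self_of_Y_ne hw]
    have hfxC : 4 * (x : ℂ) ^ 3 + (W.baseChange ℂ).b₂ * (x : ℂ) ^ 2 + 2 * (W.baseChange ℂ).b₄ * (x : ℂ) +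
        (W.baseChange ℂ).b₆ = 0 := by
      have := congrArg (fun q : ℝ ↦ (q : ℂ)) hfx
      simp only [Complex.ofReal_zero] at this
      rw [← this, cubic_ofReal]
      push_cast; ring
    have haddX : (W.baseChange ℂ).toAffine.addX r r ((W.baseChange ℂ).toAffine.slope r r s s) = X := by
      rw [hX]
      apply (addX_self_eq_iff (W.baseChange ℂ) heq hw hfxC).mpr
      have h1 : 2 * (r - (x : ℂ)) ^ 2 = 2 * ((t : ℝ) : ℂ) ^ 2 := by rw [hrdef, hr₀]; push_cast; ring
      rw [h1]
      have h := congrArg (fun q : ℝ ↦ (q : ℂ)) ht2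
      push_cast at h
      simpa only [bc_b₂, bc_b₄] using h
    have hadd := WeierstrassCurve.Affine.nonsingular_add hns hns fun hxy' ↦ hw hxy'.right
    -- the sum has abscissa `X = x`, hence is `T`
    have hYx : (W.baseChange ℂ).toAffine.Equation X Y := hP.1
    have h2C : 2 * Y + (W.baseChange ℂ).a₁ * X + (W.baseChange ℂ).a₃ = 0 := by
      rw [hX, hY, bc_a₁, bc_a₃]; exact_mod_cast congrArg (fun q : ℚ ↦ (q : ℂ)) h2
    have haddY : (W.baseChange ℂ).toAffine.addY r r s ((W.baseChange ℂ).toAffine.slope r r s s) = Y := by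
      have hE : (W.baseChange ℂ).toAffine.Equation X
          ((W.baseChange ℂ).toAffine.addY r r s ((W.baseChange ℂ).toAffine.slope r r s s)) := by
        rw [← haddX]; exact hadd.1
      exact eq_of_equation_of_two_torsion (W.baseChange ℂ) hYx h2C hE
    simp only [haddX, haddY]

end Complex

end Summit.BirchSwinnertonDyer.BirchSwinnertonDyer.Theorems.DepletionAtTwo.ArchTransport

end
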